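import Mathlib
import Summits.Ventures.PercRepro2.Defs
import Summits.Ventures.PercRepro2.Independence
import Summits.Ventures.PercRepro2.Harris
import Summits.Ventures.PercRepro2.Graph
import Summits.Ventures.PercRepro2.Events
import Summits.Ventures.PercRepro2.ZCLeafBuilt
import Summits.Ventures.PercRepro2.ZCA3WGraph
import Summits.Ventures.PercRepro2.ZCInsertP

/-!
# (ZC) on a graph with two cycles — Theorem E applied twice, then the tree theorem
(blind cell PercRepro2, mine-a g24)

Vertices `0, 1, 2, 3, 4`; edges `0 = {0,1}`, `1 = {1,2}`, `2 = {0,2}`, `3 = {2,4}`, `4 = {0,3}`,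
`5 = {3,4}` (cyclomatic number two: the triangle `0 — 1 — 2 — 0` and the four-cycle `0 — 2 — 4 — 3 — 0`);
marks `a₁ = 0`, `a₃ = 1`, `o = 3`.  The mark `a₃ = 1` has degree two with neighbours `a₁ = 0` and `w = 2`:
Theorem E (`zc_a3w_graph`) moves the `a₃`-role to `2` under `p[0, 1 ↦ 0]`, where `2` has the edges
`{0,2}`, `{2,4}` and the zero-weight edge `{1,2}`: the `p`-form of Theorem E (`zc_a3w_graph'`) moves the
role to `4` under `p[0, 1, 2, 3 ↦ 0]`, which is supported on the path `3 — 0`, `3 — 4`, where the tree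
theorem applies (marks `(0, 4, 3)`, the up-set shifted by `1` and by `2`).  Hence (ZC) holds for every
weight vector and every cluster up-set — the reductions compose because each one's hypothesis is
literally (ZC) on the reduced weighted graph.  One seat.
-/

namespace Summit.Ventures.PercRepro2

/-- **(ZC) on the two-cycle graph** above with the marks `a₁ = 0`, `a₃ = 1`, `o = 3`: every weight
vector, every up-set. -/
theorem zc_two_cycles {R : Type*} [CommRing R] [LinearOrder R] [IsStrictOrderedRing R]
    {p : Fin 6 → R} (hp : IsProbVec p) {𝓔 : Set (Set (Fin 5))} (h𝓔 : IsUpperSet 𝓔) :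
    let ends : Fin 6 → Sym2 (Fin 5) := ![s(0, 1), s(1, 2), s(0, 2), s(2, 4), s(0, 3), s(3, 4)]
    let e := connEvent ends 0 1
    let L' := connEvent ends 0 3
    let U := clusterInEvent ends 0 𝓔
    let γ := connEvent ends 1 3
    0 ≤ prob p (eᶜ ∩ L'ᶜ ∩ γᶜ) * (prob p (U ∩ (e ∩ L')) - prob p U * prob p (e ∩ L'))
      - prob p (eᶜ ∩ L'ᶜ ∩ γ) * (prob p (U ∩ (e ∩ L'ᶜ)) - prob p U * prob p (e ∩ L'ᶜ)) := by
  intro ends e L' U γ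
  -- first reduction: strip `1` (neighbours `0`, `2`)
  have hE1 := zc_a3w_graph (a₁ := (0 : Fin 5)) (a₃ := 1) (o := 3) (w := 2) (f₁ := (0 : Fin 6)) (f₂ := 1)
    hp (ends := ends) (by decide) (by simp [ends, Sym2.eq_swap]) (by simp [ends])
    (by intro e he; fin_cases e <;> simp [ends, Sym2.mem_iff] at he ⊢)
    (by decide) (by decide) h𝓔 ?_
  · simpa using hE1
  · simp only
    have hp₁ : IsProbVec (Function.update (Function.update p 0 0) 1 0) :=
      (hp.update 0 le_rfl zero_le_one).update 1 le_rfl zero_le_one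
    have h𝓔₁ : IsUpperSet {S : Set (Fin 5) | insert 1 S ∈ 𝓔} := isUpperSet_rootShift h𝓔 1
    -- second reduction: strip `2` (neighbours `0`, `4`; the edge `{1,2}` has weight `0`)
    have hE2 := zc_a3w_graph' (a₁ := (0 : Fin 5)) (a₃ := 2) (o := 3) (w := 4) (f₁ := (2 : Fin 6)) (f₂ := 3)
      hp₁ (ends := ends) (by decide) (by simp [ends, Sym2.eq_swap]) (by simp [ends])
      (by intro e he; fin_cases e <;> simp [ends, Sym2.mem_iff] at he ⊢)
      (by decide) (by decide) h𝓔₁ ?_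
    · simpa using hE2
    · simp only
      have hL := zc_of_leafBuilt (ends := ends) [((5 : Fin 6), (3 : Fin 5), (4 : Fin 5)), (4, 0, 3)]
        (by simp [ends, List.pairwise_cons, Sym2.mem_iff])
        (by simp [ends])
        (Function.update (Function.update (Function.update (Function.update p 0 0) 1 0) 2 0) 3 0)
        ((hp₁.update 2 le_rfl zero_le_one).update 3 le_rfl zero_le_one)
        (by
          intro e he
          fin_cases e <;> simp at he ⊢)
        0 4 3 {S | insert 2 S ∈ {S : Set (Fin 5) | insert 1 S ∈ 𝓔}} (isUpperSet_rootShift h𝓔₁ 2)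
      simpa using hL

end Summit.Ventures.PercRepro2
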